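import Mathlib
import Summits.Ventures.PercRepro2.HCov
import Summits.Ventures.PercRepro2.HCovCubic
import Summits.Ventures.PercRepro2.TriDisagreement
import Summits.Ventures.PercRepro2.TriDisagreementPinned
import Summits.Ventures.PercRepro2.TypedSplit
import Summits.Ventures.PercRepro2.OneTypedEdge
import Summits.Ventures.PercRepro2.StarPattern
import Summits.Ventures.PercRepro2.ChainCoeff
import Summits.Ventures.PercRepro2.StarFour
import Summits.Ventures.PercRepro2.StarFourIdentity
import Summits.Ventures.PercRepro2.StarFourMixed

/-!
# The degree-four stars under the chain condition: the hard step is the antichain leaves (blind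
cell PercRepro2, p1 g12; the degree-4 sibling of `StarChain.lean`, CONJECTURES row 2′TRI-CH)

The multi-state coefficient of a family of star blocks `B : Fin (r + 1) → Bool⁴` with counts `k`
(`chainCoeff4`, the `Bool⁴` twin of `ChainCoeff.chainCoeff`, on the same state assignments
`StarPattern.assignments`) and the chain condition `IsChain4` give **`TriCH4`** — row 2′TRI-CH at a
degree-four star: every chain coefficient is `≥ 0` (a definition only). Every chain leaf of the
five orbit-leaf identities (`star4_1111`, `star4_2111`, `star4_2211`, `star4_2221`, `star4_2222`)
is a chain coefficient (`B4one_eq_chainCoeff4`: `∅ ⊂ P` with counts `(2,1)`;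
`B4two_eq_chainCoeff4`: `(1,2)`; `Lam4_eq_chainCoeff4`: `Λ(P;Q;∅)` = `∅ ⊂ Q ⊂ P` with `(1,1,1)`;
`Lam4pp_eq_chainCoeff4_*`: `Λ(P;P;Q)`), so under `TriCH4` one rung down the hard step `N ≥ 0` is
EXACTLY its antichain leaves: **`typedCount_1111_ge_anti_of_triCH4`** (the three disjoint-pair
leaves — DEG4's left side), **`typedCount_2111_ge_anti_of_triCH4`** (nine antichain leaves),
**`typedCount_2211_ge_anti_of_triCH4`** (ten), **`typedCount_2221_ge_anti_of_triCH4`** (nine),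
**`typedCount_2222_ge_anti_of_triCH4`** (nine) — the degree-four residual in the multi-state
language, kernel-checked. No sign claim is proved.
NEG-108 (2026-08-24): the identities are unconditional; every positivity Prop is scoped in its
docstring to the one-rung-down objects of GRAPHS / the five-mark base (never typed hypergraphs).
-/

namespace Summit.Ventures.PercRepro2

open CovForm CovForm.OneTyped CovForm.TypedRed

namespace StarFour

section Chain

variable {V : Type*} {E : Type*} [Fintype E] [DecidableEq E] {R : Type*} [Field R]

/-- The componentwise order on `Bool⁴` patterns: `P ⊆ Q` as sets of star edges. -/
def patLE4 (P Q : Bool × Bool × Bool × Bool) : Prop :=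
  (P.1 = true → Q.1 = true) ∧ (P.2.1 = true → Q.2.1 = true) ∧ (P.2.2.1 = true → Q.2.2.1 = true) ∧
    (P.2.2.2 = true → Q.2.2.2 = true)

/-- `B 0 ⊂ B 1 ⊂ … ⊂ B r` is a chain of blocks starting at `∅`. -/
def IsChain4 {r : ℕ} (B : Fin (r + 1) → Bool × Bool × Bool × Bool) : Prop :=
  B 0 = (false, false, false, false) ∧
    ∀ i j : Fin (r + 1), i < j → patLE4 (B i) (B j) ∧ B i ≠ B j

/-- **The degree-four multi-state coefficient**: the pattern counts of all state assignments with
the prescribed counts (`StarPattern.assignments`). -/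
noncomputable def chainCoeff4 (ends : E → Sym2 V) (o a₁ a₂ a₃ b : V) (s₁ s₂ s₃ s₄ : E)
    (F₀ : Finset E) (z₀ : Config E) (τ : E → ℕ) {r : ℕ}
    (B : Fin (r + 1) → Bool × Bool × Bool × Bool) (k : Fin (r + 1) → ℕ) : R :=
  ∑ σ ∈ StarPattern.assignments k,
    patCount4 ends o a₁ a₂ a₃ b s₁ s₂ s₃ s₄ F₀ z₀ τ (B (σ 0)) (B (σ 1)) (B (σ 2))

/-- The one-block base is the chain `∅ ⊂ P` with counts `(2, 1)`. -/
theorem B4one_eq_chainCoeff4 (ends : E → Sym2 V) (o a₁ a₂ a₃ b : V) (s₁ s₂ s₃ s₄ : E)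
    (F₀ : Finset E) (z₀ : Config E) (τ : E → ℕ) (P : Bool × Bool × Bool × Bool) :
    B4one (R := R) ends o a₁ a₂ a₃ b s₁ s₂ s₃ s₄ F₀ z₀ τ P =
      chainCoeff4 ends o a₁ a₂ a₃ b s₁ s₂ s₃ s₄ F₀ z₀ τ ![(false, false, false, false), P]
        ![2, 1] := by
  unfold chainCoeff4 B4one
  rw [StarPattern.assignments_two_one]
  rw [Finset.sum_insert (by decide), Finset.sum_insert (by decide), Finset.sum_singleton]
  simp only [Matrix.cons_val_zero, Matrix.cons_val_one, Matrix.head_cons, Matrix.cons_val_two,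
    Matrix.tail_cons]
  ring

/-- The type-`2` base is the chain `∅ ⊂ P` with counts `(1, 2)`. -/
theorem B4two_eq_chainCoeff4 (ends : E → Sym2 V) (o a₁ a₂ a₃ b : V) (s₁ s₂ s₃ s₄ : E)
    (F₀ : Finset E) (z₀ : Config E) (τ : E → ℕ) (P : Bool × Bool × Bool × Bool) :
    B4two (R := R) ends o a₁ a₂ a₃ b s₁ s₂ s₃ s₄ F₀ z₀ τ P =
      chainCoeff4 ends o a₁ a₂ a₃ b s₁ s₂ s₃ s₄ F₀ z₀ τ ![(false, false, false, false), P]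
        ![1, 2] := by
  unfold chainCoeff4 B4two
  rw [StarPattern.assignments_one_two]
  rw [Finset.sum_insert (by decide), Finset.sum_insert (by decide), Finset.sum_singleton]
  simp only [Matrix.cons_val_zero, Matrix.cons_val_one, Matrix.head_cons, Matrix.cons_val_two,
    Matrix.tail_cons]
  ring

/-- The leaf `Λ(P;Q;∅)` is the family `∅, Q, P` with counts `(1, 1, 1)` (a chain if `Q ⊂ P`). -/
theorem Lam4_eq_chainCoeff4 (ends : E → Sym2 V) (o a₁ a₂ a₃ b : V) (s₁ s₂ s₃ s₄ : E)
    (F₀ : Finset E) (z₀ : Config E) (τ : E → ℕ) (P Q : Bool × Bool × Bool × Bool) :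
    Lam4 (R := R) ends o a₁ a₂ a₃ b s₁ s₂ s₃ s₄ F₀ z₀ τ P Q =
      chainCoeff4 ends o a₁ a₂ a₃ b s₁ s₂ s₃ s₄ F₀ z₀ τ ![(false, false, false, false), Q, P]
        ![1, 1, 1] := by
  unfold chainCoeff4 Lam4
  rw [StarPattern.assignments_one_one_one]
  rw [Finset.sum_insert (by decide), Finset.sum_insert (by decide), Finset.sum_insert (by decide),
    Finset.sum_insert (by decide), Finset.sum_insert (by decide), Finset.sum_singleton]
  simp only [Matrix.cons_val_zero, Matrix.cons_val_one, Matrix.head_cons, Matrix.cons_val_two,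
    Matrix.tail_cons]
  ring

/-- The leaf `Λ(P;P;Q)` is the family `P, Q` with counts `(2, 1)` (a chain when `P ⊂ Q`). -/
theorem Lam4pp_eq_chainCoeff4_PPQ (ends : E → Sym2 V) (o a₁ a₂ a₃ b : V) (s₁ s₂ s₃ s₄ : E)
    (F₀ : Finset E) (z₀ : Config E) (τ : E → ℕ) (P Q : Bool × Bool × Bool × Bool) :
    Lam4pp (R := R) ends o a₁ a₂ a₃ b s₁ s₂ s₃ s₄ F₀ z₀ τ P Q =
      chainCoeff4 ends o a₁ a₂ a₃ b s₁ s₂ s₃ s₄ F₀ z₀ τ ![P, Q] ![2, 1] := by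
  unfold chainCoeff4 Lam4pp
  rw [StarPattern.assignments_two_one]
  rw [Finset.sum_insert (by decide), Finset.sum_insert (by decide), Finset.sum_singleton]
  simp only [Matrix.cons_val_zero, Matrix.cons_val_one, Matrix.head_cons, Matrix.cons_val_two,
    Matrix.tail_cons]
  ring

/-- The leaf `Λ(P;P;Q)` is also the family `Q, P` with counts `(1, 2)` (a chain if `Q ⊂ P`). -/
theorem Lam4pp_eq_chainCoeff4_QQP (ends : E → Sym2 V) (o a₁ a₂ a₃ b : V) (s₁ s₂ s₃ s₄ : E)
    (F₀ : Finset E) (z₀ : Config E) (τ : E → ℕ) (P Q : Bool × Bool × Bool × Bool) :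
    Lam4pp (R := R) ends o a₁ a₂ a₃ b s₁ s₂ s₃ s₄ F₀ z₀ τ P Q =
      chainCoeff4 ends o a₁ a₂ a₃ b s₁ s₂ s₃ s₄ F₀ z₀ τ ![Q, P] ![1, 2] := by
  unfold chainCoeff4 Lam4pp
  rw [StarPattern.assignments_one_two]
  rw [Finset.sum_insert (by decide), Finset.sum_insert (by decide), Finset.sum_singleton]
  simp only [Matrix.cons_val_zero, Matrix.cons_val_one, Matrix.head_cons, Matrix.cons_val_two,
    Matrix.tail_cons]
  ring

end Chain

section Conjecture

variable {V : Type*} {E : Type*} [Fintype E] [DecidableEq E] {R : Type*} [Field R] [LinearOrder R]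

/-- **Row 2′TRI-CH at a degree-four star**: every chain coefficient of the typed instance is
nonnegative. A definition only.
SCOPE (NEG-108): conjectured for the one-rung-down objects of GRAPHS — `(F₀, z₀, τ)` the typed
edges of `G − y`, `G` a finite graph (unmarked vertices allowed), the blocks the pieces of THIS star —
and for the five-mark base; NOT for typed hypergraphs with unmarked vertices (`H*`: `N = −2`). -/
def TriCH4 (ends : E → Sym2 V) (o a₁ a₂ a₃ b : V) (s₁ s₂ s₃ s₄ : E) (F₀ : Finset E) (z₀ : Config E)
    (τ : E → ℕ) : Prop :=
  ∀ (r : ℕ) (B : Fin (r + 1) → Bool × Bool × Bool × Bool), IsChain4 B →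
    ∀ k : Fin (r + 1) → ℕ, ∑ i, k i = 3 →
      0 ≤ chainCoeff4 (R := R) ends o a₁ a₂ a₃ b s₁ s₂ s₃ s₄ F₀ z₀ τ B k

end Conjecture

section Residual

variable {V : Type*} {E : Type*} [Fintype E] [DecidableEq E] {R : Type*} [Field R] [LinearOrder R]
  [IsStrictOrderedRing R] {ends : E → Sym2 V} {o a₁ a₂ a₃ b : V} {s₁ s₂ s₃ s₄ : E}
  {y u₁ u₂ u₃ u₄ : V}

/-- **Under 2′TRI-CH (degree-four chains) the `(1, 1, 1, 1)` hard step is exactly its antichain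
leaves**: the 11 chain leaves are `≥ 0`, so `N ≥ Σ antichain leaves` (3 of them). -/
theorem typedCount_1111_ge_anti_of_triCH4 (F : Finset E) (z : Config E) (τ : E → ℕ)
    (D : StarData4 ends o a₁ a₂ a₃ b s₁ s₂ s₃ s₄ y u₁ u₂ u₃ u₄ (F4 F s₁ s₂ s₃ s₄)
      (z4 z s₁ s₂ s₃ s₄))
    (hs₁ : s₁ ∈ F) (hs₂ : s₂ ∈ F) (hs₃ : s₃ ∈ F) (hs₄ : s₄ ∈ F) (hτ₁ : τ s₁ = 1) (hτ₂ : τ s₂ = 1)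
    (hτ₃ : τ s₃ = 1) (hτ₄ : τ s₄ = 1)
    (hCH : TriCH4 (R := R) ends o a₁ a₂ a₃ b s₁ s₂ s₃ s₄ (F4 F s₁ s₂ s₃ s₄) (z4 z s₁ s₂ s₃ s₄) τ) :
    Lam4 ends o a₁ a₂ a₃ b s₁ s₂ s₃ s₄ (F4 F s₁ s₂ s₃ s₄) (z4 z s₁ s₂ s₃ s₄) τ
         (true, true, false, false) (false, false, true, true) +
      Lam4 ends o a₁ a₂ a₃ b s₁ s₂ s₃ s₄ (F4 F s₁ s₂ s₃ s₄) (z4 z s₁ s₂ s₃ s₄) τ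
         (true, false, true, false) (false, true, false, true) +
      Lam4 ends o a₁ a₂ a₃ b s₁ s₂ s₃ s₄ (F4 F s₁ s₂ s₃ s₄) (z4 z s₁ s₂ s₃ s₄) τ
         (true, false, false, true) (false, true, true, false) ≤
      typedCount F z τ (K3 ends o a₁ a₂ a₃ b : Config E → Config E → Config E → R) := by
  rw [star4_1111 F z τ D hs₁ hs₂ hs₃ hs₄ hτ₁ hτ₂ hτ₃ hτ₄]
  simp only [B4one_eq_chainCoeff4]
  have h0 := hCH _ ![(false, false, false, false), (true, true, true, true)]
    (by unfold IsChain4 patLE4; decide) ![2, 1] (by decide)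
  have h1 := hCH _ ![(false, false, false, false), (true, true, true, false)]
    (by unfold IsChain4 patLE4; decide) ![2, 1] (by decide)
  have h2 := hCH _ ![(false, false, false, false), (true, true, false, true)]
    (by unfold IsChain4 patLE4; decide) ![2, 1] (by decide)
  have h3 := hCH _ ![(false, false, false, false), (true, false, true, true)]
    (by unfold IsChain4 patLE4; decide) ![2, 1] (by decide)
  have h4 := hCH _ ![(false, false, false, false), (false, true, true, true)]
    (by unfold IsChain4 patLE4; decide) ![2, 1] (by decide)
  have h5 := hCH _ ![(false, false, false, false), (true, true, false, false)]
    (by unfold IsChain4 patLE4; decide) ![2, 1] (by decide)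
  have h6 := hCH _ ![(false, false, false, false), (true, false, true, false)]
    (by unfold IsChain4 patLE4; decide) ![2, 1] (by decide)
  have h7 := hCH _ ![(false, false, false, false), (true, false, false, true)]
    (by unfold IsChain4 patLE4; decide) ![2, 1] (by decide)
  have h8 := hCH _ ![(false, false, false, false), (false, true, true, false)]
    (by unfold IsChain4 patLE4; decide) ![2, 1] (by decide)
  have h9 := hCH _ ![(false, false, false, false), (false, true, false, true)]
    (by unfold IsChain4 patLE4; decide) ![2, 1] (by decide)
  have h10 := hCH _ ![(false, false, false, false), (false, false, true, true)]
    (by unfold IsChain4 patLE4; decide) ![2, 1] (by decide)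
  linarith

/-- **Under 2′TRI-CH (degree-four chains) the `(2, 1, 1, 1)` hard step is exactly its antichain
leaves**: the 5 chain leaves are `≥ 0`, so `N ≥ Σ antichain leaves` (9 of them). -/
theorem typedCount_2111_ge_anti_of_triCH4 (F : Finset E) (z : Config E) (τ : E → ℕ)
    (D : StarData4 ends o a₁ a₂ a₃ b s₁ s₂ s₃ s₄ y u₁ u₂ u₃ u₄ (F4 F s₁ s₂ s₃ s₄)
      (z4 z s₁ s₂ s₃ s₄))
    (hs₁ : s₁ ∈ F) (hs₂ : s₂ ∈ F) (hs₃ : s₃ ∈ F) (hs₄ : s₄ ∈ F) (hτ₁ : τ s₁ = 2) (hτ₂ : τ s₂ = 1)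
    (hτ₃ : τ s₃ = 1) (hτ₄ : τ s₄ = 1)
    (hCH : TriCH4 (R := R) ends o a₁ a₂ a₃ b s₁ s₂ s₃ s₄ (F4 F s₁ s₂ s₃ s₄) (z4 z s₁ s₂ s₃ s₄) τ) :
    Lam4 ends o a₁ a₂ a₃ b s₁ s₂ s₃ s₄ (F4 F s₁ s₂ s₃ s₄) (z4 z s₁ s₂ s₃ s₄) τ
         (true, false, true, true) (true, true, false, false) +
      Lam4 ends o a₁ a₂ a₃ b s₁ s₂ s₃ s₄ (F4 F s₁ s₂ s₃ s₄) (z4 z s₁ s₂ s₃ s₄) τ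
         (true, true, false, true) (true, false, true, false) +
      Lam4 ends o a₁ a₂ a₃ b s₁ s₂ s₃ s₄ (F4 F s₁ s₂ s₃ s₄) (z4 z s₁ s₂ s₃ s₄) τ
         (true, true, true, false) (true, false, false, true) +
      Lam4 ends o a₁ a₂ a₃ b s₁ s₂ s₃ s₄ (F4 F s₁ s₂ s₃ s₄) (z4 z s₁ s₂ s₃ s₄) τ
         (true, true, false, false) (true, false, true, false) +
      Lam4 ends o a₁ a₂ a₃ b s₁ s₂ s₃ s₄ (F4 F s₁ s₂ s₃ s₄) (z4 z s₁ s₂ s₃ s₄) τ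
         (true, true, false, false) (true, false, false, true) +
      Lam4 ends o a₁ a₂ a₃ b s₁ s₂ s₃ s₄ (F4 F s₁ s₂ s₃ s₄) (z4 z s₁ s₂ s₃ s₄) τ
         (true, true, false, false) (false, false, true, true) +
      Lam4 ends o a₁ a₂ a₃ b s₁ s₂ s₃ s₄ (F4 F s₁ s₂ s₃ s₄) (z4 z s₁ s₂ s₃ s₄) τ
         (true, false, true, false) (true, false, false, true) +
      Lam4 ends o a₁ a₂ a₃ b s₁ s₂ s₃ s₄ (F4 F s₁ s₂ s₃ s₄) (z4 z s₁ s₂ s₃ s₄) τ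
         (true, false, true, false) (false, true, false, true) +
      Lam4 ends o a₁ a₂ a₃ b s₁ s₂ s₃ s₄ (F4 F s₁ s₂ s₃ s₄) (z4 z s₁ s₂ s₃ s₄) τ
         (true, false, false, true) (false, true, true, false) ≤
      typedCount F z τ (K3 ends o a₁ a₂ a₃ b : Config E → Config E → Config E → R) := by
  rw [star4_2111 F z τ D hs₁ hs₂ hs₃ hs₄ hτ₁ hτ₂ hτ₃ hτ₄]
  simp only [B4one_eq_chainCoeff4]
  have h0 := hCH _ ![(false, false, false, false), (true, true, true, true)]
    (by unfold IsChain4 patLE4; decide) ![2, 1] (by decide)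
  have h1 := hCH _ ![(false, false, false, false), (true, true, true, false)]
    (by unfold IsChain4 patLE4; decide) ![2, 1] (by decide)
  have h2 := hCH _ ![(false, false, false, false), (true, true, false, true)]
    (by unfold IsChain4 patLE4; decide) ![2, 1] (by decide)
  have h3 := hCH _ ![(false, false, false, false), (true, false, true, true)]
    (by unfold IsChain4 patLE4; decide) ![2, 1] (by decide)
  have h4 := hCH _ ![(false, false, false, false), (false, true, true, true)]
    (by unfold IsChain4 patLE4; decide) ![2, 1] (by decide)
  linarith

/-- **Under 2′TRI-CH (degree-four chains) the `(2, 2, 1, 1)` hard step is exactly its antichain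
leaves**: the 4 chain leaves are `≥ 0`, so `N ≥ Σ antichain leaves` (10 of them). -/
theorem typedCount_2211_ge_anti_of_triCH4 (F : Finset E) (z : Config E) (τ : E → ℕ)
    (D : StarData4 ends o a₁ a₂ a₃ b s₁ s₂ s₃ s₄ y u₁ u₂ u₃ u₄ (F4 F s₁ s₂ s₃ s₄)
      (z4 z s₁ s₂ s₃ s₄))
    (hs₁ : s₁ ∈ F) (hs₂ : s₂ ∈ F) (hs₃ : s₃ ∈ F) (hs₄ : s₄ ∈ F) (hτ₁ : τ s₁ = 2) (hτ₂ : τ s₂ = 2)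
    (hτ₃ : τ s₃ = 1) (hτ₄ : τ s₄ = 1)
    (hCH : TriCH4 (R := R) ends o a₁ a₂ a₃ b s₁ s₂ s₃ s₄ (F4 F s₁ s₂ s₃ s₄) (z4 z s₁ s₂ s₃ s₄) τ) :
    Lam4 ends o a₁ a₂ a₃ b s₁ s₂ s₃ s₄ (F4 F s₁ s₂ s₃ s₄) (z4 z s₁ s₂ s₃ s₄) τ
         (true, true, true, false) (true, true, false, true) +
      Lam4pp ends o a₁ a₂ a₃ b s₁ s₂ s₃ s₄ (F4 F s₁ s₂ s₃ s₄) (z4 z s₁ s₂ s₃ s₄) τ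
         (true, true, false, false) (false, false, true, true) +
      Orb4 ends o a₁ a₂ a₃ b s₁ s₂ s₃ s₄ (F4 F s₁ s₂ s₃ s₄) (z4 z s₁ s₂ s₃ s₄) τ
         (false, true, false, true) (true, false, true, false) (true, true, false, false) +
      Orb4 ends o a₁ a₂ a₃ b s₁ s₂ s₃ s₄ (F4 F s₁ s₂ s₃ s₄) (z4 z s₁ s₂ s₃ s₄) τ
         (false, true, true, false) (true, false, false, true) (true, true, false, false) +
      Lam4 ends o a₁ a₂ a₃ b s₁ s₂ s₃ s₄ (F4 F s₁ s₂ s₃ s₄) (z4 z s₁ s₂ s₃ s₄) τ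
         (true, false, true, true) (true, true, false, false) +
      Lam4 ends o a₁ a₂ a₃ b s₁ s₂ s₃ s₄ (F4 F s₁ s₂ s₃ s₄) (z4 z s₁ s₂ s₃ s₄) τ
         (false, true, true, true) (true, true, false, false) +
      Lam4 ends o a₁ a₂ a₃ b s₁ s₂ s₃ s₄ (F4 F s₁ s₂ s₃ s₄) (z4 z s₁ s₂ s₃ s₄) τ
         (true, true, false, true) (true, false, true, false) +
      Lam4 ends o a₁ a₂ a₃ b s₁ s₂ s₃ s₄ (F4 F s₁ s₂ s₃ s₄) (z4 z s₁ s₂ s₃ s₄) τ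
         (true, true, true, false) (true, false, false, true) +
      Lam4 ends o a₁ a₂ a₃ b s₁ s₂ s₃ s₄ (F4 F s₁ s₂ s₃ s₄) (z4 z s₁ s₂ s₃ s₄) τ
         (true, true, false, true) (false, true, true, false) +
      Lam4 ends o a₁ a₂ a₃ b s₁ s₂ s₃ s₄ (F4 F s₁ s₂ s₃ s₄) (z4 z s₁ s₂ s₃ s₄) τ
         (true, true, true, false) (false, true, false, true) ≤
      typedCount F z τ (K3 ends o a₁ a₂ a₃ b : Config E → Config E → Config E → R) := by
  rw [star4_2211 F z τ D hs₁ hs₂ hs₃ hs₄ hτ₁ hτ₂ hτ₃ hτ₄]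
  simp only [B4one_eq_chainCoeff4, Lam4_eq_chainCoeff4]
  have h0 := hCH _ ![(false, false, false, false), (true, true, false, false),
      (true, true, true, true)]
    (by unfold IsChain4 patLE4; decide) ![1, 1, 1] (by decide)
  have h1 := hCH _ ![(false, false, false, false), (true, true, false, false),
      (true, true, true, false)]
    (by unfold IsChain4 patLE4; decide) ![1, 1, 1] (by decide)
  have h2 := hCH _ ![(false, false, false, false), (true, true, false, false),
      (true, true, false, true)]
    (by unfold IsChain4 patLE4; decide) ![1, 1, 1] (by decide)
  have h3 := hCH _ ![(false, false, false, false), (true, true, true, true)]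
    (by unfold IsChain4 patLE4; decide) ![2, 1] (by decide)
  linarith

/-- **Under 2′TRI-CH (degree-four chains) the `(2, 2, 2, 1)` hard step is exactly its antichain
leaves**: the 5 chain leaves are `≥ 0`, so `N ≥ Σ antichain leaves` (9 of them). -/
theorem typedCount_2221_ge_anti_of_triCH4 (F : Finset E) (z : Config E) (τ : E → ℕ)
    (D : StarData4 ends o a₁ a₂ a₃ b s₁ s₂ s₃ s₄ y u₁ u₂ u₃ u₄ (F4 F s₁ s₂ s₃ s₄)
      (z4 z s₁ s₂ s₃ s₄))
    (hs₁ : s₁ ∈ F) (hs₂ : s₂ ∈ F) (hs₃ : s₃ ∈ F) (hs₄ : s₄ ∈ F) (hτ₁ : τ s₁ = 2) (hτ₂ : τ s₂ = 2)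
    (hτ₃ : τ s₃ = 2) (hτ₄ : τ s₄ = 1)
    (hCH : TriCH4 (R := R) ends o a₁ a₂ a₃ b s₁ s₂ s₃ s₄ (F4 F s₁ s₂ s₃ s₄) (z4 z s₁ s₂ s₃ s₄) τ) :
    Orb4 ends o a₁ a₂ a₃ b s₁ s₂ s₃ s₄ (F4 F s₁ s₂ s₃ s₄) (z4 z s₁ s₂ s₃ s₄) τ
         (false, true, true, true) (true, false, true, false) (true, true, false, false) +
      Orb4 ends o a₁ a₂ a₃ b s₁ s₂ s₃ s₄ (F4 F s₁ s₂ s₃ s₄) (z4 z s₁ s₂ s₃ s₄) τ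
         (true, false, true, true) (false, true, true, false) (true, true, false, false) +
      Orb4 ends o a₁ a₂ a₃ b s₁ s₂ s₃ s₄ (F4 F s₁ s₂ s₃ s₄) (z4 z s₁ s₂ s₃ s₄) τ
         (true, true, true, false) (false, false, true, true) (true, true, false, false) +
      Orb4 ends o a₁ a₂ a₃ b s₁ s₂ s₃ s₄ (F4 F s₁ s₂ s₃ s₄) (z4 z s₁ s₂ s₃ s₄) τ
         (true, true, false, true) (false, true, true, false) (true, false, true, false) +
      Orb4 ends o a₁ a₂ a₃ b s₁ s₂ s₃ s₄ (F4 F s₁ s₂ s₃ s₄) (z4 z s₁ s₂ s₃ s₄) τ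
         (true, true, true, false) (false, true, false, true) (true, false, true, false) +
      Orb4 ends o a₁ a₂ a₃ b s₁ s₂ s₃ s₄ (F4 F s₁ s₂ s₃ s₄) (z4 z s₁ s₂ s₃ s₄) τ
         (true, true, true, false) (false, true, true, false) (true, false, false, true) +
      Lam4 ends o a₁ a₂ a₃ b s₁ s₂ s₃ s₄ (F4 F s₁ s₂ s₃ s₄) (z4 z s₁ s₂ s₃ s₄) τ
         (true, true, true, false) (true, true, false, true) +
      Lam4 ends o a₁ a₂ a₃ b s₁ s₂ s₃ s₄ (F4 F s₁ s₂ s₃ s₄) (z4 z s₁ s₂ s₃ s₄) τ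
         (true, true, true, false) (true, false, true, true) +
      Lam4 ends o a₁ a₂ a₃ b s₁ s₂ s₃ s₄ (F4 F s₁ s₂ s₃ s₄) (z4 z s₁ s₂ s₃ s₄) τ
         (true, true, true, false) (false, true, true, true) ≤
      typedCount F z τ (K3 ends o a₁ a₂ a₃ b : Config E → Config E → Config E → R) := by
  rw [star4_2221 F z τ D hs₁ hs₂ hs₃ hs₄ hτ₁ hτ₂ hτ₃ hτ₄]
  simp only [B4two_eq_chainCoeff4, Lam4_eq_chainCoeff4]
  have h0 := hCH _ ![(false, false, false, false), (true, true, true, false),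
      (true, true, true, true)]
    (by unfold IsChain4 patLE4; decide) ![1, 1, 1] (by decide)
  have h1 := hCH _ ![(false, false, false, false), (true, true, true, false)]
    (by unfold IsChain4 patLE4; decide) ![1, 2] (by decide)
  have h2 := hCH _ ![(false, false, false, false), (true, true, false, false),
      (true, true, true, true)]
    (by unfold IsChain4 patLE4; decide) ![1, 1, 1] (by decide)
  have h3 := hCH _ ![(false, false, false, false), (true, false, true, false),
      (true, true, true, true)]
    (by unfold IsChain4 patLE4; decide) ![1, 1, 1] (by decide)
  have h4 := hCH _ ![(false, false, false, false), (false, true, true, false),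
      (true, true, true, true)]
    (by unfold IsChain4 patLE4; decide) ![1, 1, 1] (by decide)
  linarith

/-- **Under 2′TRI-CH (degree-four chains) the `(2, 2, 2, 2)` hard step is exactly its antichain
leaves**: the 5 chain leaves are `≥ 0`, so `N ≥ Σ antichain leaves` (9 of them). -/
theorem typedCount_2222_ge_anti_of_triCH4 (F : Finset E) (z : Config E) (τ : E → ℕ)
    (D : StarData4 ends o a₁ a₂ a₃ b s₁ s₂ s₃ s₄ y u₁ u₂ u₃ u₄ (F4 F s₁ s₂ s₃ s₄)
      (z4 z s₁ s₂ s₃ s₄))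
    (hs₁ : s₁ ∈ F) (hs₂ : s₂ ∈ F) (hs₃ : s₃ ∈ F) (hs₄ : s₄ ∈ F) (hτ₁ : τ s₁ = 2) (hτ₂ : τ s₂ = 2)
    (hτ₃ : τ s₃ = 2) (hτ₄ : τ s₄ = 2)
    (hCH : TriCH4 (R := R) ends o a₁ a₂ a₃ b s₁ s₂ s₃ s₄ (F4 F s₁ s₂ s₃ s₄) (z4 z s₁ s₂ s₃ s₄) τ) :
    Orb4 ends o a₁ a₂ a₃ b s₁ s₂ s₃ s₄ (F4 F s₁ s₂ s₃ s₄) (z4 z s₁ s₂ s₃ s₄) τ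
         (false, true, true, true) (true, false, true, true) (true, true, false, false) +
      Orb4 ends o a₁ a₂ a₃ b s₁ s₂ s₃ s₄ (F4 F s₁ s₂ s₃ s₄) (z4 z s₁ s₂ s₃ s₄) τ
         (true, true, true, true) (false, false, true, true) (true, true, false, false) +
      Orb4 ends o a₁ a₂ a₃ b s₁ s₂ s₃ s₄ (F4 F s₁ s₂ s₃ s₄) (z4 z s₁ s₂ s₃ s₄) τ
         (false, true, true, true) (true, true, false, true) (true, false, true, false) +
      Orb4 ends o a₁ a₂ a₃ b s₁ s₂ s₃ s₄ (F4 F s₁ s₂ s₃ s₄) (z4 z s₁ s₂ s₃ s₄) τ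
         (true, true, true, true) (false, true, false, true) (true, false, true, false) +
      Orb4 ends o a₁ a₂ a₃ b s₁ s₂ s₃ s₄ (F4 F s₁ s₂ s₃ s₄) (z4 z s₁ s₂ s₃ s₄) τ
         (false, true, true, true) (true, true, true, false) (true, false, false, true) +
      Orb4 ends o a₁ a₂ a₃ b s₁ s₂ s₃ s₄ (F4 F s₁ s₂ s₃ s₄) (z4 z s₁ s₂ s₃ s₄) τ
         (true, true, true, true) (false, true, true, false) (true, false, false, true) +
      Orb4 ends o a₁ a₂ a₃ b s₁ s₂ s₃ s₄ (F4 F s₁ s₂ s₃ s₄) (z4 z s₁ s₂ s₃ s₄) τ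
         (true, false, true, true) (true, true, false, true) (false, true, true, false) +
      Orb4 ends o a₁ a₂ a₃ b s₁ s₂ s₃ s₄ (F4 F s₁ s₂ s₃ s₄) (z4 z s₁ s₂ s₃ s₄) τ
         (true, false, true, true) (true, true, true, false) (false, true, false, true) +
      Orb4 ends o a₁ a₂ a₃ b s₁ s₂ s₃ s₄ (F4 F s₁ s₂ s₃ s₄) (z4 z s₁ s₂ s₃ s₄) τ
         (true, true, false, true) (true, true, true, false) (false, false, true, true) ≤
      typedCount F z τ (K3 ends o a₁ a₂ a₃ b : Config E → Config E → Config E → R) := by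
  rw [star4_2222 F z τ D hs₁ hs₂ hs₃ hs₄ hτ₁ hτ₂ hτ₃ hτ₄]
  simp only [B4two_eq_chainCoeff4, Lam4_eq_chainCoeff4]
  have h0 := hCH _ ![(false, false, false, false), (true, true, true, true)]
    (by unfold IsChain4 patLE4; decide) ![1, 2] (by decide)
  have h1 := hCH _ ![(false, false, false, false), (true, true, true, false),
      (true, true, true, true)]
    (by unfold IsChain4 patLE4; decide) ![1, 1, 1] (by decide)
  have h2 := hCH _ ![(false, false, false, false), (true, true, false, true),
      (true, true, true, true)]
    (by unfold IsChain4 patLE4; decide) ![1, 1, 1] (by decide)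
  have h3 := hCH _ ![(false, false, false, false), (true, false, true, true),
      (true, true, true, true)]
    (by unfold IsChain4 patLE4; decide) ![1, 1, 1] (by decide)
  have h4 := hCH _ ![(false, false, false, false), (false, true, true, true),
      (true, true, true, true)]
    (by unfold IsChain4 patLE4; decide) ![1, 1, 1] (by decide)
  linarith

end Residual

end StarFour

end Summit.Ventures.PercRepro2
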